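import Summits.RiemannHypothesis.RiemannHypothesis.Theorems.GroundBartaEvenWinsBeyondArchDeflationRN83EWinF
import HarnessLib

/-!
# RiemannHypothesis / GroundBarta — rung 4 (`EvenWinsBeyondArch`): R-layer certificate of cell `RN83E` — projection constants

Generated by `tools/rgen/gen4.py` = prover A g12's four-slot ((2, 3, 4, 5)-window) port of prover B's `tools/rgen/gen.py consts` (prover B / A g12): `re83Mc` (midpoint of the certified bracket of the window's Markov constant) and
`re83Wd = diag(ρ̃)` (prover A's Ritz values), the coefficients `W_il = W̃_il + δ_il (M̃ − M_c)` of the sigma criterion.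
-/

set_option linter.dupNamespace false

noncomputable section

open MeasureTheory Set Filter intervalIntegral
open scoped Topology BigOperators

namespace Summit.RiemannHypothesis.RiemannHypothesis.Theorems.EvenWinsBeyondArch

open Literature.NumberTheory.LFunctions
open Literature.Analysis.ValidatedNumerics Literature.Analysis.ValidatedNumerics.PolyMP
  Literature.Analysis.ValidatedNumerics.NumericsMP Literature.Analysis.ValidatedNumerics.ExpPoly
/-- `M̃`: midpoint of the certified bracket of `M_{83/100}` -/
def re83Mc : ℚ := ((97536819755564870201749 : ℚ)/10000000000000000000000)
/-- `W̃ = diag(ρ̃)` (A's Ritz values) -/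
def re83Wd : Fin 9 → Fin 9 → ℚ := fun a l ↦ if a = l then (![((24078509 : ℚ)/50000000000000000000000000), ((34246651 : ℚ)/100000000000000000000), ((8729493 : ℚ)/250000000000000), ((18455641 : ℚ)/50000000000), ((29674513 : ℚ)/100000000), ((79627647 : ℚ)/100000000), ((3554681 : ℚ)/4000000), ((2633481 : ℚ)/2000000), ((13300321 : ℚ)/10000000)] : Fin 9 → ℚ) a else 0

end Summit.RiemannHypothesis.RiemannHypothesis.Theorems.EvenWinsBeyondArch

end
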